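import Literature.AlgebraicGeometry.Resolution.DecompositionLayerDensity
import Literature.AlgebraicGeometry.Resolution.DenseRegularDescent
import Literature.AlgebraicGeometry.Resolution.NormalAscentCompletion
import HarnessLib

/-!
# [CoP1] Prop. 9.3, decomposition layer, in the frame: "`R` is regular since `S′` is" — the regularity of a normal model of `M` below a regular model of `K′ ⊆ Kˢ`

Topic: `Literature/AlgebraicGeometry/Resolution`. PROOF side of `CossartPiltant2019ReductionP`
(`ArithmeticalThreefoldsLocal.lean`), input (C4), hypothesis `hDec` of
`cossartPiltant2019ReductionP_of_cjs_of_stableInertiaHensel`. The last sentence of the proof of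
[CoP1] Prop. 9.3 (HAL p. 28: "Now, `R` is regular since `S′` is by (45)"), in the frame of the
chain: if `S[t₁] ⊆ O ∩ M` is a NORMAL model of `M` containing the Galois-approximation
coefficients, `S[t₁ ∪ t₁′]` its integral closure in `K′` (`M ≤ K′ ≤ Kˢ`), and the local ring
`R₁′ = locAtCentre S[t₁ ∪ t₁′]` is REGULAR of the same dimension as `R₁ = (S[t₁])_𝔪`, then
`R₁` is regular — i.e. `S[t₁]` is a local uniformization of `M` in the currency of `hDec`.
Assembly of `exists_finset_unramified_locAtCentre` (`DecompositionLayerDensity.lean`: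
`𝔪_{R₁}R₁′ = 𝔪_{R₁′}`, trivial residue extension), analytic irreducibility of the excellent
normal local ring `R₁` (`IsExcellentRing.isDomain_and_isIntegrallyClosed_adicCompletion`,
`NormalAscentCompletion.lean`) and `isRegularLocalRing_of_dense` (`DenseRegularDescent.lean`).

* `exists_finset_isRegularLocalRing_of_regular` — PROVED.

Everything is PROVED; no named facts, definitions, instances or notation are introduced.

## Sources

* V. Cossart, O. Piltant, J. Algebra 320 (2008) 1051–1082: proof of Prop. 9.3, (45) and last
  sentence (HAL hal-00139124, pp. 27–28). [CossartPiltant2008]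
-/

noncomputable section

open IsLocalRing Polynomial IntermediateField
open scoped Pointwise

namespace Literature.AlgebraicGeometry.Resolution

universe u

/-- Elements of the subfield generated by `S` and `t` are fractions of elements of `S[t]`.
[folklore] -/
private theorem exists_div_eq_of_mem_closure₂ {S Ω : Type u} [CommRing S] [Field Ω] [Algebra S Ω]
    (t : Set Ω) {z : Ω} (hz : z ∈ Subfield.closure (Set.range (algebraMap S Ω) ∪ t)) :
    ∃ a b : Ω, a ∈ Algebra.adjoin S t ∧ b ∈ Algebra.adjoin S t ∧ b ≠ 0 ∧ z = a / b := by
  obtain ⟨y, hy, w, hw, hyw⟩ := Subfield.mem_closure_iff.mp hz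
  rw [← Algebra.adjoin_eq_ring_closure] at hy hw
  by_cases hw0 : w = 0
  · refine ⟨0, 1, zero_mem _, one_mem _, one_ne_zero, ?_⟩
    rw [← hyw, hw0, div_zero, zero_div]
  · exact ⟨y, w, hy, hw, hw0, hyw.symm⟩

set_option maxHeartbeats 800000 in
/-- **[CoP1] Prop. 9.3: "`R` is regular since `S′` is", in the frame.** For `S` excellent and
`N | M` finite Galois inside `E` there is a finite `c ⊆ O ∩ M` such that: for every `K′` with
`M ≤ K′ ≤ Kˢ`, every normal model `S[t₁] ⊆ O ∩ M` of `M` containing `c` and its integral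
closure `S[t₁ ∪ t₁′]` in `K′`, IF the local ring `locAtCentre S[t₁ ∪ t₁′]` is regular and has
the same dimension as `(S[t₁])_𝔪`, THEN `(S[t₁])_𝔪` is regular (in the local-uniformization
currency `Localization.AtPrime (𝔪_O ∩ S[t₁])` of `hDec`).
[cite: CossartPiltant2008, proof of Prop. 9.3, (45) and last sentence (HAL pp. 27–28)] -/
theorem exists_finset_isRegularLocalRing_of_regular
    (S : Type u) [CommRing S] (hS : IsExcellentRing S)
    (E : Type u) [Field E] [Algebra S E]
    (OE : ValuationSubring E)
    (M : Subfield E) (hSM : ∀ s : S, algebraMap S E s ∈ M)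
    (N : IntermediateField M E) [FiniteDimensional M N] [IsGalois M N] :
    ∃ c : Finset E, (c : Set E) ⊆ (M : Set E) ∧ (∀ x ∈ c, x ∈ OE) ∧
      ∀ (K' : Subfield E), M ≤ K' → K' ≤ N.toSubfield →
        K' ≤ (lift (fixedField (decompositionGroupIn OE N))).toSubfield →
      ∀ (t₁ : Finset E), (t₁ : Set E) ⊆ M →
        M ≤ Subfield.closure (Set.range (algebraMap S E) ∪ (t₁ : Set E)) →
      ∀ (ht₁O : (Algebra.adjoin S (t₁ : Set E)).toSubring ≤ OE.toSubring),
        (∀ x : E, x ∈ M → IsIntegral (Algebra.adjoin S (t₁ : Set E)) x →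
          x ∈ Algebra.adjoin S (t₁ : Set E)) →
        (c : Set E) ⊆ Algebra.adjoin S (t₁ : Set E) →
      ∀ (t₁' : Finset E), (t₁' : Set E) ⊆ K' →
        (∀ x : E, x ∈ K' → (IsIntegral (Algebra.adjoin S (t₁ : Set E)) x ↔
          x ∈ Algebra.adjoin S ((t₁ : Set E) ∪ (t₁' : Set E)))) →
      ∀ (hO' : (Algebra.adjoin S ((t₁ : Set E) ∪ (t₁' : Set E))).toSubring ≤ OE.toSubring),
        IsRegularLocalRing (locAtCentre (Algebra.adjoin S ((t₁ : Set E) ∪ (t₁' : Set E))).toSubring OE) →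
        ringKrullDim (Localization.AtPrime
            (Ideal.comap (Subring.inclusion ht₁O) (maximalIdeal OE))) =
          ringKrullDim (locAtCentre (Algebra.adjoin S ((t₁ : Set E) ∪ (t₁' : Set E))).toSubring OE) →
        IsRegularLocalRing (Localization.AtPrime
          (Ideal.comap (Subring.inclusion ht₁O) (maximalIdeal OE))) := by
  classical
  haveI : IsNoetherianRing S := hS.isUniversallyCatenaryRing.1
  obtain ⟨c, hcM, hcO, hunr⟩ := exists_finset_unramified_locAtCentre S E OE M hSM N
  refine ⟨c, hcM, hcO, ?_⟩
  intro K' hMK' hK'N hK'Z t₁ ht₁M hMcl ht₁O hnorm hct₁ t₁' ht₁'K' hext hO' hreg' hdim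
  obtain ⟨hle, hm, hres⟩ :=
    hunr K' hMK' hK'N hK'Z t₁ ht₁M hMcl ht₁O hnorm hct₁ t₁' ht₁'K' hext hO'
  -- the model `T = S[t₁]`, its centre `P₀`, the local ring `A = T_{P₀}`
  set T : Subalgebra S E := Algebra.adjoin S (t₁ : Set E) with hTdef
  set T' : Subalgebra S E := Algebra.adjoin S ((t₁ : Set E) ∪ (t₁' : Set E)) with hT'def
  let P₀ : Ideal T := Ideal.comap (Subring.inclusion ht₁O) (maximalIdeal OE)
  haveI : P₀.IsPrime := Ideal.IsPrime.comap _
  have hP₀ : ∀ z : T, z ∈ P₀ ↔ OE.valuation (z : E) < 1 := fun z => by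
    change Subring.inclusion ht₁O z ∈ maximalIdeal OE ↔ _
    rw [ValuationSubring.valuation_lt_one_iff]
    rfl
  let A : Type u := Localization.AtPrime P₀
  set R₁ : Subring E := locAtCentre T.toSubring OE with hR₁def
  set R₁' : Subring E := locAtCentre T'.toSubring OE with hR₁'def
  haveI hR₁loc : IsLocalRing R₁ := isLocalRing_locAtCentre ht₁O
  haveI hR₁'loc : IsLocalRing R₁' := isLocalRing_locAtCentre hO'
  haveI : IsRegularLocalRing R₁' := hreg'
  -- `T` is of finite type, `A` is excellent, Noetherian, an integrally closed domain
  haveI : Algebra.FiniteType S T :=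
    (Subalgebra.fg_iff_finiteType _).mp (Subalgebra.fg_adjoin_finset _)
  haveI : IsNoetherianRing T := Algebra.FiniteType.isNoetherianRing S T
  have hAexc : IsExcellentRing A := isExcellentRing_localization_atPrime hS P₀
  haveI : IsNoetherianRing A := hAexc.isUniversallyCatenaryRing.1
  haveI : IsDomain A := IsLocalization.isDomain_localization P₀.primeCompl_le_nonZeroDivisors
  -- `T` is integrally closed (in its fraction field `M`)
  let MS : Subalgebra S E := { M.toSubring with algebraMap_mem' := fun s => hSM s }
  have hTM : T ≤ MS := Algebra.adjoin_le ht₁M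
  have hfrac : ∀ z ∈ M, ∃ a ∈ T.toSubring, ∃ b ∈ T.toSubring, b ≠ 0 ∧ z = a / b := by
    intro z hz
    obtain ⟨a, b, ha, hb, hb0, hzab⟩ := exists_div_eq_of_mem_closure₂ (t₁ : Set E) (hMcl hz)
    exact ⟨a, ha, b, hb, hb0, hzab⟩
  haveI : IsIntegrallyClosed T := by
    let K : Type u := M
    letI : Algebra T K := ((algebraMap T E).codRestrict M (fun b => hTM b.2)).toAlgebra
    haveI : IsScalarTower T K E := IsScalarTower.of_algebraMap_eq fun _ => rfl
    have hinj : Function.Injective (algebraMap T K) := fun a b hab => by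
      apply Subtype.ext
      have := congrArg (fun z : K => (z : E)) hab
      exact this
    haveI : FaithfulSMul T K := (faithfulSMul_iff_algebraMap_injective T K).mpr hinj
    haveI : IsFractionRing T K := by
      refine IsFractionRing.of_field T K fun z => ?_
      obtain ⟨a, ha, b, hb, -, hz⟩ := hfrac z z.2
      exact ⟨⟨a, ha⟩, ⟨b, hb⟩, Subtype.ext hz⟩
    refine (isIntegrallyClosed_iff K).mpr (fun {x} hx => ?_)
    have hxE : IsIntegral T (x : E) := hx.map (IsScalarTower.toAlgHom T K E)
    exact ⟨⟨(x : E), hnorm x x.2 hxE⟩, Subtype.ext rfl⟩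
  haveI : IsIntegrallyClosed A :=
    isIntegrallyClosed_of_isLocalization A P₀.primeCompl P₀.primeCompl_le_nonZeroDivisors
  haveI : IsDomain (AdicCompletion (maximalIdeal A) A) :=
    (hAexc.isDomain_and_isIntegrallyClosed_adicCompletion).1
  -- `A ≅ R₁` (both localizations of `T` at the centre; `P₀` is `subringCentre` by definition)
  let e : A ≃+* R₁ := (locAtCentreEquiv ht₁O).toRingEquiv
  -- the dense local homomorphism `A → R₁′`
  let f : A →+* R₁' := (Subring.inclusion hle).comp e.toRingHom
  have hmf : (maximalIdeal A).map f = maximalIdeal R₁' := by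
    rw [← Ideal.map_map,
      IsLocalRing.map_maximalIdeal_of_surjective e.toRingHom (fun y => e.surjective y)]
    exact hm
  have hresf : ∀ b : R₁', ∃ a : A, b - f a ∈ maximalIdeal R₁' := by
    intro b
    obtain ⟨a, ha⟩ := hres b
    refine ⟨e.symm a, ?_⟩
    change b - Subring.inclusion hle (e.toRingHom (e.symm a)) ∈ maximalIdeal R₁'
    rw [RingEquiv.toRingHom_eq_coe, RingEquiv.coe_toRingHom, RingEquiv.apply_symm_apply]
    exact ha
  haveI : IsNoetherianRing T' := by
    haveI : Algebra.FiniteType S T' := by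
      rw [hT'def, ← Finset.coe_union]
      exact (Subalgebra.fg_iff_finiteType _).mp (Subalgebra.fg_adjoin_finset _)
    exact Algebra.FiniteType.isNoetherianRing S T'
  let eT : T' ≃+* T'.toSubring :=
    { toFun := fun x => ⟨x.1, x.2⟩
      invFun := fun x => ⟨x.1, x.2⟩
      left_inv := fun _ => rfl
      right_inv := fun _ => rfl
      map_mul' := fun _ _ => rfl
      map_add' := fun _ _ => rfl }
  haveI : IsNoetherianRing T'.toSubring := isNoetherianRing_of_ringEquiv T' eT
  haveI : IsNoetherianRing R₁' :=
    IsLocalization.isNoetherianRing (subringCentre T'.toSubring OE hO').primeCompl _ inferInstance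
  exact isRegularLocalRing_of_dense f hmf hresf hdim hreg'

end Literature.AlgebraicGeometry.Resolution

end
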